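import Mathlib.CategoryTheory.SingleObj
import Mathlib.CategoryTheory.PUnit
import Mathlib.Algebra.Group.PUnit
import Mathlib.Algebra.Group.Hom.Basic
import Literature.AlgebraicGeometry.Frobenioids.DivisorMonoidCategoryTheoreticityCorSchemaNegative
import HarnessLib

/-!
# Frobenioids I, Thm. 3.4 (i) (istr square), (ii), (iii) and Prop. 3.11 (iii): the universal closures
# of the typed per-instance schemata over the BARE operations interface are FALSE

Mochizuki, *The geometry of Frobenioids I: the general theory*, Kyushu J. Math. **62** (2008)
293–400, Thm. 3.4 p. 62, Prop. 3.11 p. 73 [cite: MochizukiFrdI2008, Thm. 3.4 (ii) p.62].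

PROOF-ONLY companion (no definitions, no instances) of `BaseCategoryTheoreticity.lean` (seat
abc-iut-f-018, FACT-LIST tranche 18: F-0898 `PreFrobenioidData.Prop311iii`, F-0901
`PreFrobenioidData.Thm34i_istr`, F-0902 `PreFrobenioidData.Thm34ii`, F-0903 `PreFrobenioidData.Thm34iii`;
kernel_closedness `parametrised`). Those four declarations are *conclusion predicates* in the operations
`S_i : PreFrobenioidData C_i D_i` (the data `(Base, Φ, Div, deg_Fr)` of Def. 1.1 (iv) WITHOUT the
Frobenioid axioms of Def. 1.3) and an ARBITRARY equivalence `Ψ : C₁ ≌ C₂` (for (i) also arbitrary functors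
`istr_i : C_i ⥤ C_i^istr`); the paper asserts them for Frobenioids. This file records, by kernel-checked
counterexamples, that their UNIVERSAL CLOSURES over the bare interface (all operations, all `Ψ`, at
universe level `0`) are false — so a consumer may never take `∀ S₁ S₂ Ψ, …` as a hypothesis — and points to
the INSTANCE FORMS over Frobenioids, which are theorems of the tree (cited, not restated):

* Prop. 3.11 (iii): `FrdI.prop311iii_ofFunctor` (`GroupLikeBaseFunctorProofs.lean`), closed form
  `FrdI.Prop311ii_iii` (`CategoryTheoreticityFacts.lean`, F-0705, proved);
* Thm. 3.4 (i), istr square: `PreFrobenioid.thm34i_istr_ofFunctor` (`EquivalenceIstrSquare.lean`), at THE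
  isotropification functors of Prop. 1.9 (v);
* Thm. 3.4 (ii): `FrdI.thm34ii_ofFunctor`, `FrdI.Thm34ii_holds` (`EquivalencePreStepsFSMFF2008Assembly.lean`,
  F-0711);
* Thm. 3.4 (iii): `FrdI.Thm34iii_holds` (ibid., F-0712).

THE JUNK MODELS (the carrier is that of the sibling negatives
`DivisorMonoidCategoryTheoreticityCorSchemaNegative.lean`, seat abc-iut-f-032, whose "no anchors in
`B(N_{≥1})`" is reused). All live on the one-object category `B(N_{≥1}) = SingleObj ℕ+` (arrows = positive
integers under multiplication) with base functor constant at an object of a base category all of whose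
arrows are invertible (`Discrete PUnit`, or `SingleObj G` for a group `G`; of FSMFF-type vacuously),
constant divisor monoid `M` with identity pull-backs, `Div ≡ 0`, and `deg_Fr` an endomorphism `e` of `ℕ+`
with trivial kernel (`id` or `n ↦ n²`) — `exists_ops`. Then a linear arrow is `1`, hence invertible, so
every object is isotropic, and no object is an iso-subanchor; the operations are of quasi-isotropic type,
and for `M ≠ 0` of standard type (condition (b) vacuous). The four refutations: (ii) `Ψ = 𝟭` does not carry
the group-like object of `(M = 0)` to a group-like object of `(M = ℕ)`; (iii) `deg_Fr = id` versus
`deg_Fr = n²` forces `Ψ^{N_{≥1}} = (n ↦ n²) ≠ id` although both sides admit non-group-like objects; (i) with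
`istr₁ = 𝟭` and the junk CONSTANT `istr₂`, any `Ψ^istr` making the square `1`-commute kills all arrows,
so it is not faithful; Prop. 3.11 (iii) with `D₁ = Discrete PUnit`, `D₂ = SingleObj ℤ` admits no
equivalence `Ψ^Base : D₁ ⥤ D₂`. A refuted closure is a statement about the typing, not about the paper;
no statement of the paper is restated or strengthened; no side is taken on [IUTchIII] Cor. 3.12.
-/

namespace Literature.AlgebraicGeometry.Frobenioids

open CategoryTheory

namespace PreFrobenioidData

namespace SchemaNegativeThm34

/-! ### Junk operations on `B(N_{≥1})`: generic consequences of "linear ⇒ invertible" -/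

section Generic

variable {D : Type} [Category.{0} D] (S : PreFrobenioidData.{0} (SingleObj ℕ+) D)
  (hlin : ∀ {x y : SingleObj ℕ+} (φ : x ⟶ y), S.IsLinear φ → IsIso φ)

include hlin in
/-- If linear arrows are invertible, `B(N_{≥1})` is of isotropic type (an isometric pre-step is linear).
[cite: MochizukiFrdI2008, Def. 1.2 (v) p.23] -/
theorem isOfIsotropicType : S.IsOfIsotropicType := ⟨fun _ _ φ hφ => hlin φ hφ.1.1⟩

include hlin in
/-- … hence the operations are of quasi-isotropic type (no object of `B(N_{≥1})` is an iso-subanchor,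
`CorSchemaNegative.not_isIsoSubanchor`). [cite: MochizukiFrdI2008, Def. 3.1 (i) p.56] -/
theorem isOfQuasiIsotropicType : S.IsOfQuasiIsotropicType :=
  ⟨fun A => ⟨fun h => (h ((isOfIsotropicType S hlin).obj A)).elim,
    fun h _ => CorSchemaNegative.not_isIsoSubanchor A h⟩⟩

include hlin in
/-- If moreover every arrow is an isometric base-isomorphism, `Φ ≠ 0` at the object (so that (b) is
vacuous), `Φ` is non-dilating and `D` is of FSMFF-type, the operations are of standard type.
[cite: MochizukiFrdI2008, Def. 3.1 (i) p.56] -/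
theorem isOfStandardType (hdiv : ∀ {x y : SingleObj ℕ+} (φ : x ⟶ y), S.IsIsometry φ)
    (hbase : ∀ {x y : SingleObj ℕ+} (φ : x ⟶ y), S.IsBaseIso φ)
    (hM : ∃ m : S.Mon (S.base.obj (SingleObj.star ℕ+)), m ≠ 1) (hnd : S.IsNonDilatingOn)
    (hD : IsOfFSMFFType D) : S.IsOfStandardType where
  quasiIsotropic := isOfQuasiIsotropicType S hlin
  frobeniusIsotropic := ⟨fun A => ⟨A, 𝟙 A, ⟨⟨fun _ _ _ β _ _ _ hβ _ => hlin β hβ.1.1, hdiv _⟩, hbase _⟩,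
    (isOfIsotropicType S hlin).obj A⟩⟩
  frobeniusCompact_of_groupLike h := by
    obtain ⟨m, hm⟩ := hM
    exact (hm (h.obj (SingleObj.star ℕ+) m)).elim
  frobeniusNormalized := ⟨fun A φ _ α hα => by
    haveI := hlin α hα.2
    have h1 : α = (1 : End A) := CorSchemaNegative.eq_one_of_isIso α
    rw [h1, one_pow, one_mul, mul_one]⟩
  fsmff := hD
  nonDilating := hnd

/-- With `Φ ≠ 0` at the object, hypothesis (b) `HypB` is vacuous. [cite: MochizukiFrdI2008, Thm. 3.4 (iii) p.62] -/
theorem hypB (hM : ∃ m : S.Mon (S.base.obj (SingleObj.star ℕ+)), m ≠ 1) {D₂ : Type} [Category.{0} D₂]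
    (S₂ : PreFrobenioidData.{0} (SingleObj ℕ+) D₂) (Ψ : SingleObj ℕ+ ≌ SingleObj ℕ+) : HypB S S₂ Ψ :=
  fun h => by
    obtain ⟨m, hm⟩ := hM
    exact (hm (h.obj (SingleObj.star ℕ+) m)).elim

include hlin in
/-- With `Φ = 0` and `D` of FSMFF-type the operations satisfy the setting of Prop. 3.11 (isotropic,
unit-trivial — a unit is linear, hence `1` — and group-like). [cite: MochizukiFrdI2008, Prop. 3.11 p.73] -/
theorem prop311Setting (hzero : ∀ (Y : D) (m : S.Mon Y), m = 1) (hD : IsOfFSMFFType D) :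
    Prop311Setting S where
  zero := hzero
  fsmff := hD
  isotropic := isOfIsotropicType S hlin
  unitTrivial := ⟨fun A => (Subgroup.eq_bot_iff_forall _).2 fun α hα => by
    haveI := hlin α.hom hα.2
    exact Iso.ext (CorSchemaNegative.eq_one_of_isIso α.hom)⟩
  groupLike := ⟨fun A m => hzero _ m⟩

end Generic

/-! ### Existence of the junk operations -/

/-- Junk operations on `B(N_{≥1})` EXIST over every base with an object `X`: base functor constant at `X`,
constant divisor monoid `M` with identity pull-backs, `Div = 0`, `deg_Fr = e` for an endomorphism `e` of
`N_{≥1}` with trivial kernel (then linear arrows are `1`, hence invertible). NOT the operations of any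
Frobenioid; a counterexample carrier only. [cite: MochizukiFrdI2008, Def. 1.1 (iv) p.20] -/
theorem exists_ops {D : Type} [Category.{0} D] (X : D) (M : Type) [CommMonoid M] (e : ℕ+ →* ℕ+)
    (he : ∀ n, e n = 1 → n = 1) :
    ∃ S : PreFrobenioidData.{0} (SingleObj ℕ+) D,
      (∀ {x y : SingleObj ℕ+} (φ : x ⟶ y), S.degFr φ = e φ) ∧
      (∀ {x y : SingleObj ℕ+} (φ : x ⟶ y), S.IsLinear φ → IsIso φ) ∧
      (∀ {x y : SingleObj ℕ+} (φ : x ⟶ y), S.IsIsometry φ) ∧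
      (∀ {x y : SingleObj ℕ+} (φ : x ⟶ y), S.IsBaseIso φ) ∧
      (∀ {x : SingleObj ℕ+} (φ : x ⟶ x), S.IsBaseIdentity φ) ∧
      S.IsNonDilatingOn ∧
      (Subsingleton M → ∀ (Y : D) (m : S.Mon Y), m = 1) ∧
      ((∃ a : M, a ≠ 1) → ∃ m : S.Mon (S.base.obj (SingleObj.star ℕ+)), m ≠ 1) := by
  refine ⟨{ base := (Functor.const _).obj X
            Mon := fun _ => M
            pull := fun _ => MonoidHom.id M
            pull_id := fun _ _ => rfl
            pull_comp := fun _ _ _ => rfl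
            div := fun _ => 1
            degFr := fun φ => e φ
            div_id := fun _ => rfl
            div_comp := fun _ _ => by rw [MonoidHom.id_apply, one_pow, mul_one]
            degFr_id := fun _ => map_one e
            degFr_comp := fun ψ φ => by
              rw [SingleObj.comp_as_mul, map_mul, mul_comm] },
    fun _ => rfl, fun φ hφ => CorSchemaNegative.isIso_of_eq_one φ (he _ hφ), fun _ => rfl,
    fun _ => ?_, fun _ => rfl, ⟨fun Y f _ a => Quotient.inductionOn a fun m => rfl⟩,
    fun _ _ _ => Subsingleton.elim _ _, fun ⟨a, ha⟩ => ⟨a, ha⟩⟩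
  change IsIso (𝟙 X)
  infer_instance

/-- `n ↦ n²` has trivial kernel on `N_{≥1}`. [cite: MochizukiFrdI2008, Def. 1.1 (iv) p.20] -/
theorem powMonoidHom_two_eq_one (n : ℕ+) (h : powMonoidHom 2 n = 1) : n = 1 := by
  have h2 : (n : ℕ) * n = 1 := by
    have := congrArg PNat.val h
    rwa [powMonoidHom_apply, sq, PNat.mul_coe] at this
  exact PNat.coe_eq_one_iff.mp (Nat.eq_one_of_mul_eq_one_right h2)

end SchemaNegativeThm34

open SchemaNegativeThm34

/-! ### The four refutations -/

/-- **The universal closure of the typed `PreFrobenioidData.Thm34ii` is false** (F-0902): over the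
bare operations interface, with `Ψ = 𝟭` on `B(N_{≥1})` and the junk operations `(Φ = 0, deg_Fr = id)`,
`(Φ = ℕ, deg_Fr = id)` (both of quasi-isotropic type over the FSMFF base `Discrete PUnit`), the unique
object is group-like for the first and not for the second. The INSTANCE FORM over Frobenioids is the
theorem `FrdI.thm34ii_ofFunctor` / the closed fact `FrdI.Thm34ii_holds` (F-0711).
[cite: MochizukiFrdI2008, Thm. 3.4 (ii) p.62] -/
theorem not_forall_thm34ii :
    ¬ ∀ {C₁ : Type} [Category.{0} C₁] {D₁ : Type} [Category.{0} D₁]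
        {C₂ : Type} [Category.{0} C₂] {D₂ : Type} [Category.{0} D₂]
        (S₁ : PreFrobenioidData.{0} C₁ D₁) (S₂ : PreFrobenioidData.{0} C₂ D₂) (Ψ : C₁ ≌ C₂),
        S₁.Thm34ii S₂ Ψ := by
  intro h
  have hD : IsOfFSMFFType (Discrete PUnit.{1}) :=
    (⟨fun f _ => inferInstance⟩ : IsOfFSMType (Discrete PUnit.{1})).isOfFSMFFType
  obtain ⟨S₁, -, hlin₁, -, -, -, -, hzero₁, -⟩ :=
    exists_ops (⟨⟨⟩⟩ : Discrete PUnit.{1}) PUnit (MonoidHom.id ℕ+) fun _ h => h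
  obtain ⟨S₂, -, hlin₂, -, -, -, -, -, hM₂⟩ :=
    exists_ops (⟨⟨⟩⟩ : Discrete PUnit.{1}) (Multiplicative ℕ) (MonoidHom.id ℕ+) fun _ h => h
  obtain ⟨m, hm⟩ := hM₂ ⟨Multiplicative.ofAdd 1, by simp⟩
  obtain ⟨-, -, hgl⟩ := h S₁ S₂ CategoryTheory.Equivalence.refl (isOfQuasiIsotropicType S₁ hlin₁)
    (isOfQuasiIsotropicType S₂ hlin₂) hD hD
  have h1 : S₁.IsGroupLikeObj (SingleObj.star ℕ+) := fun x => hzero₁ inferInstance _ x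
  exact hm (hgl h1 m)

/-- **The universal closure of the typed `PreFrobenioidData.Thm34iii` is false** (F-0903): with
`Ψ = 𝟭` on `B(N_{≥1})`, `Φ = ℕ`, and `deg_Fr = id` versus `deg_Fr = (n ↦ n²)` (both of standard type over
`Discrete PUnit`, hypothesis (b) vacuous), the automorphism `Ψ^{N_{≥1}}` of `N_{≥1}` would have to be
`n ↦ n²` and, both sides admitting non-group-like objects, the identity. The INSTANCE FORM over Frobenioids
is the closed fact `FrdI.Thm34iii_holds` (F-0712). [cite: MochizukiFrdI2008, Thm. 3.4 (iii) p.62] -/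
theorem not_forall_thm34iii :
    ¬ ∀ {C₁ : Type} [Category.{0} C₁] {D₁ : Type} [Category.{0} D₁]
        {C₂ : Type} [Category.{0} C₂] {D₂ : Type} [Category.{0} D₂]
        (S₁ : PreFrobenioidData.{0} C₁ D₁) (S₂ : PreFrobenioidData.{0} C₂ D₂) (Ψ : C₁ ≌ C₂),
        S₁.Thm34iii S₂ Ψ := by
  intro h
  have hD : IsOfFSMFFType (Discrete PUnit.{1}) :=
    (⟨fun f _ => inferInstance⟩ : IsOfFSMType (Discrete PUnit.{1})).isOfFSMFFType
  have ha : ∃ a : Multiplicative ℕ, a ≠ 1 := ⟨Multiplicative.ofAdd 1, by simp⟩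
  obtain ⟨S₁, hdeg₁, hlin₁, hdiv₁, hbase₁, -, hnd₁, -, hM₁⟩ :=
    exists_ops (⟨⟨⟩⟩ : Discrete PUnit.{1}) (Multiplicative ℕ) (MonoidHom.id ℕ+) fun _ h => h
  obtain ⟨S₂, hdeg₂, hlin₂, hdiv₂, hbase₂, -, hnd₂, -, hM₂⟩ :=
    exists_ops (⟨⟨⟩⟩ : Discrete PUnit.{1}) (Multiplicative ℕ) (powMonoidHom 2) powMonoidHom_two_eq_one
  obtain ⟨-, ΨN, hΨN, hrefl⟩ := h S₁ S₂ CategoryTheory.Equivalence.refl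
    (isOfStandardType S₁ hlin₁ hdiv₁ hbase₁ (hM₁ ha) hnd₁ hD)
    (isOfStandardType S₂ hlin₂ hdiv₂ hbase₂ (hM₂ ha) hnd₂ hD) (hypB S₁ (hM₁ ha) S₂ _)
  obtain ⟨m₁, hm₁⟩ := hM₁ ha
  obtain ⟨m₂, hm₂⟩ := hM₂ ha
  have hN : ΨN = MulEquiv.refl ℕ+ :=
    hrefl ⟨SingleObj.star ℕ+, fun hg => hm₁ (hg m₁)⟩ ⟨SingleObj.star ℕ+, fun hg => hm₂ (hg m₂)⟩
  have key := hΨN (A := SingleObj.star ℕ+) (B := SingleObj.star ℕ+) (2 : ℕ+)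
  rw [hdeg₂, hN] at key
  have key' : powMonoidHom 2 (2 : ℕ+) = MulEquiv.refl ℕ+ (MonoidHom.id ℕ+ (2 : ℕ+)) := key.trans (by rw [hdeg₁])
  have k2 := congrArg PNat.val key'
  simp at k2

/-- **The universal closure of the typed `PreFrobenioidData.Thm34i_istr` is false** (F-0901): the
schema quantifies over ARBITRARY functors `istr_i : C_i ⥤ C_i^istr` (print: THE isotropifications); with
`Ψ = 𝟭` on `B(N_{≥1})` (`Φ = 0`, `deg_Fr = id`, quasi-isotropic over `Discrete PUnit`), `istr₁` the
identity-on-objects functor and `istr₂` the junk CONSTANT functor, any `Ψ^istr` with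
`𝟭 ⋙ istr₂ ≅ istr₁ ⋙ Ψ^istr` kills every arrow, so it is not faithful, hence no equivalence. The INSTANCE
FORM over Frobenioids, at the isotropification functors of Prop. 1.9 (v), is the theorem
`PreFrobenioid.thm34i_istr_ofFunctor`. [cite: MochizukiFrdI2008, Thm. 3.4 (i) p.62] -/
theorem not_forall_thm34i_istr :
    ¬ ∀ {C₁ : Type} [Category.{0} C₁] {D₁ : Type} [Category.{0} D₁]
        {C₂ : Type} [Category.{0} C₂] {D₂ : Type} [Category.{0} D₂]
        (S₁ : PreFrobenioidData.{0} C₁ D₁) (S₂ : PreFrobenioidData.{0} C₂ D₂) (Ψ : C₁ ≌ C₂)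
        (istr₁ : C₁ ⥤ S₁.Istr) (istr₂ : C₂ ⥤ S₂.Istr), S₁.Thm34i_istr S₂ Ψ istr₁ istr₂ := by
  intro h
  obtain ⟨S, -, hlin, -⟩ := exists_ops (⟨⟨⟩⟩ : Discrete PUnit.{1}) PUnit (MonoidHom.id ℕ+) fun _ h => h
  let X₀ : S.Istr := ⟨SingleObj.star ℕ+, (isOfIsotropicType S hlin).obj _⟩
  let istr₁ : SingleObj ℕ+ ⥤ S.Istr := S.isotropicObjects.lift (𝟭 _) (isOfIsotropicType S hlin).obj
  obtain ⟨Ψi, ⟨hEq, ⟨ε⟩, -⟩, -⟩ := h S S CategoryTheory.Equivalence.refl istr₁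
    ((Functor.const _).obj X₀) (isOfQuasiIsotropicType S hlin) (isOfQuasiIsotropicType S hlin)
  -- `Ψ^istr` kills every endomorphism of `X₀ = istr₁ ⋆`
  have hkill : ∀ n : istr₁.obj (SingleObj.star ℕ+) ⟶ istr₁.obj (SingleObj.star ℕ+),
      Ψi.map n = 𝟙 _ := fun n => by
    have hn : 𝟙 _ ≫ ε.hom.app (SingleObj.star ℕ+) = ε.hom.app (SingleObj.star ℕ+) ≫ Ψi.map n :=
      ε.hom.naturality (X := SingleObj.star ℕ+) (Y := SingleObj.star ℕ+) n.hom
    rw [Category.id_comp] at hn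
    exact (cancel_epi (ε.hom.app (SingleObj.star ℕ+))).mp (hn.symm.trans (Category.comp_id _).symm)
  -- but `istr₁ ⋆` has the distinct endomorphisms `2` and `1`
  haveI := hEq.faithful
  have h21 : (ObjectProperty.homMk (2 : ℕ+) : istr₁.obj (SingleObj.star ℕ+) ⟶ istr₁.obj (SingleObj.star ℕ+)) =
      𝟙 _ := Ψi.map_injective (by rw [hkill, hkill])
  have h2 : (2 : ℕ) = 1 :=
    congrArg (fun f : istr₁.obj (SingleObj.star ℕ+) ⟶ istr₁.obj (SingleObj.star ℕ+) => PNat.val f.hom) h21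
  omega

/-- **The universal closure of the typed `PreFrobenioidData.Prop311iii` is false** (F-0898): with
`C₁ = C₂ = B(N_{≥1})`, `Ψ = 𝟭`, `Φ = 0`, `deg_Fr = id` (the setting of Prop. 3.11 holds on both sides and
`Ψ^{±1}` preserve base-identity endomorphisms trivially) but bases `D₁ = Discrete PUnit` and
`D₂ = SingleObj ℤ` (all arrows invertible, so of FSMFF-type), there is no equivalence `Ψ^Base : D₁ ⥤ D₂`
at all. The INSTANCE FORM over Frobenioids is the theorem `FrdI.prop311iii_ofFunctor` (closed fact
`FrdI.Prop311ii_iii`, F-0705, proved). [cite: MochizukiFrdI2008, Prop. 3.11 (iii) p.73] -/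
theorem not_forall_prop311iii :
    ¬ ∀ {C₁ : Type} [Category.{0} C₁] {D₁ : Type} [Category.{0} D₁]
        {C₂ : Type} [Category.{0} C₂] {D₂ : Type} [Category.{0} D₂]
        (S₁ : PreFrobenioidData.{0} C₁ D₁) (S₂ : PreFrobenioidData.{0} C₂ D₂) (Ψ : C₁ ≌ C₂),
        S₁.Prop311iii S₂ Ψ := by
  intro h
  have hD₁ : IsOfFSMFFType (Discrete PUnit.{1}) :=
    (⟨fun f _ => inferInstance⟩ : IsOfFSMType (Discrete PUnit.{1})).isOfFSMFFType
  have hD₂ : IsOfFSMFFType (SingleObj (Multiplicative ℤ)) :=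
    (⟨fun f _ => IsIso.of_groupoid f⟩ : IsOfFSMType (SingleObj (Multiplicative ℤ))).isOfFSMFFType
  obtain ⟨S₁, -, hlin₁, -, -, hbid₁, -, hzero₁, -⟩ :=
    exists_ops (⟨⟨⟩⟩ : Discrete PUnit.{1}) PUnit (MonoidHom.id ℕ+) fun _ h => h
  obtain ⟨S₂, -, hlin₂, -, -, hbid₂, -, hzero₂, -⟩ :=
    exists_ops (SingleObj.star (Multiplicative ℤ)) PUnit (MonoidHom.id ℕ+) fun _ h => h
  obtain ⟨ΨB, ⟨hEq, -, -⟩, -⟩ := h S₁ S₂ CategoryTheory.Equivalence.refl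
    (prop311Setting S₁ hlin₁ (hzero₁ inferInstance) hD₁)
    (prop311Setting S₂ hlin₂ (hzero₂ inferInstance) hD₂) (fun _ _ _ => hbid₂ _) (fun _ _ _ => hbid₁ _)
  haveI := hEq.full
  obtain ⟨f, hf⟩ := ΨB.map_surjective (X := ⟨⟨⟩⟩) (Y := ⟨⟨⟩⟩) (Multiplicative.ofAdd (1 : ℤ))
  rw [Subsingleton.elim f (𝟙 _), ΨB.map_id, SingleObj.id_as_one] at hf
  have hf' := congrArg Multiplicative.toAdd hf
  simp at hf'

end PreFrobenioidData

end Literature.AlgebraicGeometry.Frobenioids
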